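import Summits.QuantumFields.YangMills.Theorems.ParabolicTrajectoryLatticeGapOnTrajectoryScalingDefs
import Summits.QuantumFields.YangMills.Theorems.BalabanStepParabolic.Negative.OverTunedEquivalence
import Summits.QuantumFields.YangMills.Theorems.BalabanStepParabolic.Negative.FaceContact

/-!
# Crux `LatticeGapOnTrajectory` (stmt-QuantumFields-10523), line `trajectory-gap-scaling` — negative-side support:
# the hardest stub `stub_arcCertificate : ArcCertificate` is at least UOT-strong and false modulo the face-contact hypothesis

`ArcCertificate` posits, for every compact simple `G` and `r`, an ODD block factor `M'` and an inhabitant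
`S : BalabanBanachStep G r M'` (plus `UVSmall S`, curve data and the tube certificate `ClustersOn`).  By the kernel-checked
negative record of the sibling item `BalabanStepParabolic` (stmt-QuantumFields-9684), odd-`M` inhabitation of the
hypothesis structure is EQUIVALENT to uniform over-tuned triviality `UOT(r, M, B)` of Wilson's lattice gauge theory
(`Negative.nonempty_iff_uniformOverTuned`), an RG-free statement nobody can prove today.  Hence any proof of
`stub_arcCertificate` proves `∃ B > 0, UOT(r, M', B)` for every compact simple `G` — before the IR certificate
`ClustersOn` and the volume-uniform asymptotic-freedom bound `UVSmall` are even touched.  This file records that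
implication (sorry-free), and the sharper inheritance of the sibling item's MIS-STATEMENT: under the disprover's
face-contact hypothesis `H = FaceContactHypothesis` (plaquette-covariance positivity + nearest-neighbour lower bound for
`SU(2)`, both open) the structure has NO odd-`M` inhabitant for `SU(2)` (`Negative.not_nonempty_of_faceContact`), so
`ArcCertificate` is FALSE modulo `H` (`arcCertificate_false_of_faceContactHypothesis`): the chart lines of this crux stand or
fall with the (4c)-repair of `BalabanBanachStep` recorded for stmt-9684.  Support file (`--supports stmt-QuantumFields-10523`,
registered sub-goal `arcCertificate_false_of_faceContactHypothesis`) by the line lead prover-line-stmt-QuantumFields-10523-c1-0;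
NOT a refutation of anything (H is open) — it documents why the line was declared dead (Lines/trajectory-gap-scaling.dead.md).
-/

open scoped SchwartzMap
open MeasureTheory Filter Topology
open Literature.MathematicalPhysics.QuantumFieldTheory Literature.MathematicalPhysics.QuantumLattice
open Literature.MathematicalPhysics.AQFT

noncomputable section

namespace Summit.QuantumFields.YangMills.Theorems.LatticeGapOnTrajectory.Negative

open Summit.QuantumFields.YangMills.Cruxes.LatticeGapOnTrajectory.TrajectoryGapScaling

/-- `ArcCertificate` yields an odd-factor inhabitant of Bałaban's hypothesis structure for every compact simple `G`. -/
theorem arcCertificate_nonempty_odd (hA : ArcCertificate) (G : Type) [Group G] [TopologicalSpace G]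
    [IsTopologicalGroup G] [CompactSpace G] [MeasurableSpace G] [BorelSpace G]
    (hG : IsCompactSimpleLieGroup G) (r : LatticeRep G) :
    ∃ M' : ℕ, Odd M' ∧ Nonempty (BalabanBanachStep G r M') := by
  obtain ⟨M', hM', S, -⟩ := hA G hG r
  exact ⟨M', hM', ⟨S⟩⟩

/-- **`ArcCertificate` is at least UOT-strong**: it implies, for every compact simple `G` and `r`, uniform
over-tuned triviality of Wilson's theory at some odd block factor and some slope `B > 0`
(via `Negative.uniformOverTuned_of_nonempty`). -/
theorem arcCertificate_uniformOverTuned (hA : ArcCertificate) (G : Type) [Group G] [TopologicalSpace G]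
    [IsTopologicalGroup G] [CompactSpace G] [MeasurableSpace G] [BorelSpace G]
    (hG : IsCompactSimpleLieGroup G) (r : LatticeRep G) :
    ∃ M' : ℕ, Odd M' ∧ ∃ B : ℝ, 0 < B ∧
      ∀ (B' : ℝ) (L m : ℕ) (h : Fin (m + 1) → 𝓢(EuclideanSpace ℝ (Fin 4), ℝ)),
        IsOffDiagonal (SchwartzMap.tensorFin (m + 1) fun i => ofRealTest (h i)) →
        ∀ ε > 0, ∃ k₀ : ℕ, ∀ k ≥ k₀, ∀ β : ℝ, B * k - B' ≤ β →
          |wilsonCentredSchwinger r.ρ β ((M' ^ k * (2 * L + 1) - 1) / 2) (fun _ => 1) (m + 1)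
            (fun _ => r.curvature) (fun i => (blockDilate M')^[k] (h i))| ≤ ε := by
  obtain ⟨M', hM', hS⟩ := arcCertificate_nonempty_odd hA G hG r
  exact ⟨M', hM', Summit.QuantumFields.YangMills.Theorems.BalabanStepParabolic.Negative.uniformOverTuned_of_nonempty
    r M' hM' hS⟩

/-- **`ArcCertificate` is false modulo the face-contact hypothesis** of the `BalabanStepParabolic` negative record:
for `G = SU(2)` (certified compact simple: `isSimpleCompactGroup_specialUnitaryGroup_holds`) and Wilson's fundamental action
no odd-`M'` inhabitant of `BalabanBanachStep` exists under `H` (`Negative.not_nonempty_of_faceContact`), whereas the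
certificate posits one (with any Borel structure, in particular `borel`). Classification: the stub inherits the
mis-statement of field (4c) (periodic face contact); NOT a refutation (H is open). -/
theorem arcCertificate_false_of_faceContactHypothesis : Summit.QuantumFields.YangMills.Theorems.BalabanStepParabolic.Negative.FaceContactHypothesis → ¬ ArcCertificate := by
  intro h hA
  letI : MeasurableSpace (Matrix.specialUnitaryGroup (Fin 2) ℂ) := borel _
  haveI : BorelSpace (Matrix.specialUnitaryGroup (Fin 2) ℂ) := ⟨rfl⟩
  have hG : IsCompactSimpleLieGroup (Matrix.specialUnitaryGroup (Fin 2) ℂ) :=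
    isCompactSimpleLieGroup_specialUnitaryGroup isSimpleCompactGroup_specialUnitaryGroup_holds le_rfl
  obtain ⟨M', hM', hS⟩ := arcCertificate_nonempty_odd hA (Matrix.specialUnitaryGroup (Fin 2) ℂ) hG
    Summit.QuantumFields.YangMills.Theorems.BalabanStepParabolic.Negative.su2Fundamental
  exact Summit.QuantumFields.YangMills.Theorems.BalabanStepParabolic.Negative.not_nonempty_of_faceContact
    _ h.1 h.2 hM' hS

end Summit.QuantumFields.YangMills.Theorems.LatticeGapOnTrajectory.Negative

end
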